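import Literature.MathematicalPhysics.QuantumFieldTheory.Balaban1983to89.B9Eq326G1kSliceGradRowClosed
import Literature.MathematicalPhysics.QuantumFieldTheory.Balaban1983to89.B9Eq3126H1SupRowOfLetters
import Literature.MathematicalPhysics.QuantumFieldTheory.Balaban1983to89.B9Eq3126QG1QInvPointDecayTowerDiagonalClosed
import Literature.MathematicalPhysics.QuantumFieldTheory.Balaban1983to89.B9Eq3126H1BlockDecayOfLettersTower
import Literature.MathematicalPhysics.QuantumFieldTheory.Balaban1983to89.B9Eq315QkSingleBondLetter
import Literature.MathematicalPhysics.QuantumFieldTheory.Balaban1983to89.B9Eq349BlockDistanceWeight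

/-!
# `Balaban1983to89.B9Eq3126H1kSliceGradRowClosed` — T. Bałaban, *Propagators for lattice gauge theories in a background field*, Commun. Math. Phys. **99** (1985)
# 389–434 [Balaban1985BackgroundPropagators] (3.126) p. 420 (*«HB = GQ\*(QGQ\*)⁻¹B»*), (3.132)–(3.133) p. 422, Thm 3.3 p. 399 (*«G(U) satisfies (3.42)»* — its
# GRADIENT member), Thm 3.11 p. 416, with [Balaban1985Variational] (45) p. 285, (115) p. 294, (117) p. 295: **THE SLICE-GRADIENT ROW OF THE TOWER MINIMIZER
# `H₁,k(U) = G₁,kQ_k†(Q_kG₁,kQ_k†)⁻¹` (coarse bonds → fine bonds) ON PRINT's DIAGONAL, `∃ (α₁, B, δ)` BEFORE THE HEIGHT** — the NE9 owner's plan v12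
# (`t4/b2b-balaban-t4-ne9-p1/g96/PLAN-V12-117-SOCKET.md` §1, the `H₁,k` line: «gradient row OPEN … S after (K65)»), typed: this lineage's (K63)
# `B9Eq3126H1SupRowOfLetters.local_letter_H1_torus_const` with the OUTER factor `G := ∇_μ∘G₁,k` (an endomorphism of the fine bond carrier) read from the owner's (E2)
# `B9Eq326G1kSliceGradRowClosed.exists_local_gradLetter_G1k` (output blocks `Π∘btgt`, re-based at `Π∘bpos` at the price `e^{κ}` —
# `B9Eq33CovDerivLocalLetterTower.tdist_bigBlock_bpos_btgt_le_one`), the `Q_k†` letter := ne9-leaf-03's (SBLT) `B9Eq315QkSingleBondLetter.norm_adjoint_QkW_apply_le_local_sharp`,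
# the coarse point decay of `(Q_kG₁,kQ_k†)⁻¹` := ne9-leaf-03's (FCLK) `B9Eq3126QG1QInvPointDecayTowerDiagonalClosed.exists_bondPoint_decay_Kinv_diagonal_closed` — (K65)'s
# assembly BYTE FOR BYTE but for the outer factor

statement-level skeleton of published theorems with citation tags; proofs where landed; nothing here is a claim about the Yang–Mills mass gap

CITATION HEADER (lean-in-tree rule).  Audit cell `pub-balaban`, sub-cell `t4`, BINDER row NE9; filed by NE9 crux-team LEAF PROVER 05
(`b2b-balaban-t4-ne9-formalise-leaf-05`, gen 87).  Composed BY NAME, nothing restated: (K63), (E2), (SBLT), (FCLK) as above; `B9Eq3126H1BlockDecayOfLettersTower.toCLM_H1k_eq`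
(`H₁,k = G₁,k∘Q_k†∘K⁻¹`); `B9Eq326OperatorTower.QkW_surjective`; ne9-leaf-01's `B9Eq349BlockMultipliers.exists_block_clm_family`; `B9Eq349BlockDistanceWeight.tdist_shift_le_one`;
the owner's (VGT-a) `B9Eq326LocalPartTowerSliceGradientRow.norm_covGrad_apply_le_of_slice` (the `∇_U` reading of the slice derivative) and (E2)'s slice device
(`covDerivL2K ∘ₗ WL2.linearEquiv.symm ∘ₗ LinearMap.funLeft ∘ₗ WL2.linearEquiv`, an `⟨_, rfl⟩` continuous linear map — no definition).
Sources READ first-hand this generation (`paper:balaban1985-cmp99-background-propagators`, journal page = PDF page + 388): p. 391 (3.3), p. 397 (3.42), p. 399 Thm 3.3,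
p. 420 (3.126).  NOTHING of print's proof is reproduced; no constant of print is valued.

WHAT IS PROVED (sorry-free; proof lane — no `def`; [folklore] composition BY NAME).
* **`exists_local_gradLetter_H1k`** — `∃ α₁ B δ > 0` BEFORE `∀ n η c₀ c₁ m U …` ((K65)'s data block VERBATIM = (K64)'s + (FCLK)'s `hαL`, then `(μ : Fin d) (b)`): for every
  coarse-bond field `z` supported over the bonds at base point `v` with `‖z(b′)‖ ≤ F`, every component `μ` and fine bond `b`:
  `‖(D_U(H₁,kz)_μ)(b)‖ ≤ B·e^{−δ·d_m(Π(b₋), v)}·F` and `‖(∇_UH₁,kz)(b, μ)‖ ≤ B·e^{−δ·d_m(Π(b₋), v)}·F` (output indexed by the bond's BASE block; the TIP block costs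
  another `e^{δ}` by `letter_reblock`).  Rates: `κ := min(δ_D, r₁)`, `δ := κ∕2`; `α₁ := min(α_D, α_K)`;
  `B = (A_K√d)·(M_Qe^{κ})·K_d(κ∕2)·(B_De^{κ})·K_d(κ∕2)`, `M_Q = M_φ′M_φ·e^{100d(d+1)L^dA_Q}·2d`.
HONEST SCOPE.  The gradient companion of (K65) (value row); consumer: the gradient of the middle word `H₁,kQ_kG₁,k` of `𝔊̃_k` (plan v12 (P2)).  A theorem about the
cell's MODEL; constants crude; nothing of [B9] Thm 3.1 ∕ 3.3 ∕ 3.11 ∕ 3.13 or [B11] (117) asserted, valued or discharged; «NE9 ⇐ the named binders»; NE9 NOT PRINTED ∕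
NOT PROVED; row WALLED ON A MODEL (O-NE9-1; #5 UNRULED); spine PROVED 0∕9; rung (B)+1 on a finite T⁴ — NOT infinite volume, NOT mass gap, NOT BetaPertH, NOT Clay.
HONEST DEPENDENCY: continuum YM on T⁴ ⇐ BetaPertH ∧ nine spine estimates (0/9 proved); BetaPertH ⇐ (D1) ∧ (D4) ∧ CAP+tail; G-an2-4 gates asym, D1 and NE2/3/4.
NEW file behind the owner's (E2) (olean); nothing modified.  Net new unproved facts: 0.
-/

noncomputable section

set_option autoImplicit false

open scoped InnerProductSpace ComplexConjugate BigOperators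

namespace Literature.MathematicalPhysics.QuantumFieldTheory.Balaban1983to89.B9Eq3126H1kSliceGradRowClosed

open B4Sect5Torus (TSite tdist tdist_nonneg tdist_symm tdist_self tdist_triangle)
open B4Sect5Proof (latticeConst latticeConst_nonneg)
open B9SectCLatticeCarrier (Bond DirPair bpos btgt shift unshift)
open B9Eq311L2Pairing (WL2)
open B9Eq319QprimeTorus (fineP blockCoord)
open B7Prop1Explicit (U1 Wcx boxVec)
open B11Eq103H1Complex (SiteL2K BondL2K KinvLatticeK covDerivL2K)
open B9Eq33CovDerivVector (covGrad)
open B9Eq310DeltaPrime (plaqHolU)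
open B9Eq310HessianOperator (adTransportW)
open B9Eq315QTorus (perCfg cornerSite)
open B9Eq315QTower (towerP UlevOf)
open B9Eq316TowerFlatIsOneStep (towerP_eq_fineP_pow siteCast)
open B9Eq326OperatorTower (QkW laplaceAk G1k H1k QkW_surjective)
open B9Eq324DeltaPrimeATower (laplacePrimeAk)
open B9Eq349BlockMultipliers (exists_block_clm_family)
open B9Eq349BlockDistanceWeight (tdist_shift_le_one)
open B9Eq33CovDerivLocalLetterTower (tdist_bigBlock_bpos_btgt_le_one)
open B9Eq326G1kSliceGradRowClosed (exists_local_gradLetter_G1k)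
open B9Eq326LocalPartTowerSliceGradientRow (norm_covGrad_apply_le_of_slice)
open B9Eq3126H1SupRowOfLetters (local_letter_H1_torus_const)
open B9Eq3126QG1QInvPointDecayTowerDiagonalClosed (exists_bondPoint_decay_Kinv_diagonal_closed)
open B9Eq3126H1BlockDecayOfLettersTower (toCLM_H1k_eq)
open B9Eq315QkSingleBondLetter (norm_adjoint_QkW_apply_le_local_sharp)

variable {d : ℕ} (hd : 1 ≤ d) (L : ℕ) [NeZero L] (hL : 1 ≤ L) (hL3 : 3 ≤ L)
  {𝔸 : Type*} [NormedRing 𝔸] [NormedAlgebra ℂ 𝔸] [CompleteSpace 𝔸] [NormOneClass 𝔸] [StarRing 𝔸] [NormedStarGroup 𝔸] [StarModule ℂ 𝔸]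
  {W : Type*} [NormedAddCommGroup W] [InnerProductSpace ℂ W] [FiniteDimensional ℂ W] (φ : W ≃ₗ[ℂ] 𝔸)
  {Mφ Mφ' : ℝ} (hMφ : 0 ≤ Mφ) (hMφ' : 0 ≤ Mφ') (hφ : ∀ w, ‖φ w‖ ≤ Mφ * ‖w‖) (hφ' : ∀ X, ‖φ.symm X‖ ≤ Mφ' * ‖X‖) (hstar : ∀ X : 𝔸, ‖star X‖ ≤ ‖X‖)
  {a : ℝ} (ha : 0 < a) {a' : ℝ} (ha' : 0 < a') {ϱ : ℝ} (hϱ0 : 0 ≤ ϱ) (hϱ1 : ϱ < 1)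
  (τ : 𝔸 →ₗ[ℂ] ℂ) {Cτ : ℝ} (hτ : ∀ X, ‖τ X‖ ≤ Cτ * ‖X‖) (hCτ : 0 ≤ Cτ) {Mτ : ℝ} (hτm : ∀ X Y : 𝔸, ‖τ (X * Y)‖ ≤ Mτ * ‖X‖ * ‖Y‖) (hMτ : 0 ≤ Mτ)
  {ρw : ℝ} (hρw : 0 ≤ ρw)
  (hτ₁ : ∀ X : 𝔸, τ (star X) = conj (τ X)) (hτ₂ : ∀ X Y : 𝔸, τ (X * Y) = τ (Y * X)) (hφτ : ∀ X Y : 𝔸, ⟪φ.symm X, φ.symm Y⟫_ℂ = τ (star X * Y))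
  (AQ : ℝ)

omit [NeZero L] in
/-- `e^{−r t} ≤ e^{−κ t}` for `κ ≤ r`, `0 ≤ t`. [folklore] -/
private theorem exp_weaken' {r κ t : ℝ} (hκ : κ ≤ r) (ht : 0 ≤ t) : Real.exp (-(r * t)) ≤ Real.exp (-(κ * t)) :=
  Real.exp_le_exp.2 (by nlinarith)

include hd hL hL3 hMφ hMφ' hφ hφ' hstar ha ha' hϱ0 hϱ1 hτ hCτ hτm hMτ hρw hτ₁ hτ₂ hφτ in
/-- **THE SLICE-GRADIENT ROW OF `H₁,k(U)` ON PRINT's DIAGONAL, UNCONDITIONAL on the cell's MODEL letters.**  (K63) `local_letter_H1_torus_const` at the tower with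
`G := ∇_μ∘G₁,k` — (E2)'s slice device post-composed with `G₁,k`, its letter (E2) `exists_local_gradLetter_G1k` (`(α_D, B_D, δ_D)`, output `Π∘btgt`) re-based at `Π∘bpos`
(`tdist_bigBlock_bpos_btgt_le_one`, price `e^{κ}`); `Qa := Q_k†` with (SBLT)'s letter (size AND range), `Kinv := (Q_kG₁,kQ_k†)⁻¹` with (FCLK)'s point decay
(`(α_K, A_K, r₁)`), `hQ := QkW_surjective … hαL`, `(∇_μ∘G₁,k)∘Q_k†∘K⁻¹ = ∇_μ∘H₁,k` by `toCLM_H1k_eq`; `κ := min(δ_D, r₁)`, `δ := κ∕2`, `α₁ := min(α_D, α_K)`; the `∇_U`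
member by `norm_covGrad_apply_le_of_slice`. [cite: Balaban1985BackgroundPropagators, (3.126) p.420, (3.133) p.422, (3.3) p.391, Thm 3.3 p.399, Thm 3.11 p.416;
Balaban1985Variational, (45) p.285, (117) p.295] -/
theorem exists_local_gradLetter_H1k :
    ∃ α₁ B δ : ℝ, 0 < α₁ ∧ 0 ≤ B ∧ 0 < δ ∧
      ∀ (n : ℕ) (η : ℝ) (_hηL : η * (L : ℝ) ^ (n + 1) = 1) (c₀ c₁ : ℝ) [Fact (0 < c₀)] [Fact (0 < c₁)]
        (_hw : c₀ * ((L : ℝ) ^ (n + 1)) ^ d = c₁) (_hρ : |η| ^ d / c₀ ≤ ρw) (m : Fin d → ℕ) [∀ i, NeZero (m i)] (_hm : ∀ i, 1 ≤ m i)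
        (U : Bond d (towerP L m (n + 1)) → 𝔸ˣ) (αU : ℕ → ℝ) (_hα0 : ∀ j, 0 ≤ αU j) (hα1 : ∀ j, αU j ≤ 1 / 64)
        (hαL : ∀ j, 50 * (d + 1) * αU j * (L : ℝ) ^ d ≤ 1 / 2)
        (hU1 : ∀ (j : ℕ) (x : B7Prop1Explicit.Site d) (k : Fin d), perCfg (towerP L m (j + 1)) (UlevOf L m (n + 1) U j) x k ∈ U1 𝔸)
        (hreg : ∀ (j : ℕ) (y : TSite d (towerP L m j)) (k : Fin d) (ρ' : Fin d → Fin L),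
          ‖((Wcx L (perCfg (towerP L m (j + 1)) (UlevOf L m (n + 1) U j)) (cornerSite L y) k (boxVec L ρ') : 𝔸ˣ) : 𝔸) - 1‖ ≤ αU j)
        (εU : ℕ → ℝ) (_hεU : ∀ j, 0 ≤ εU j) (_hUε : ∀ (j : ℕ) (b : Bond d (towerP L m (j + 1))), ‖(UlevOf L m (n + 1) U j b : 𝔸) - 1‖ ≤ εU j)
        (_hLb : ∀ (j : ℕ) (b : Bond d (towerP L m (j + 1))), UlevOf L m (n + 1) U j b ∈ U1 𝔸)
        (α : ℝ) (_hα : 0 ≤ α) (_hαle : α ≤ α₁)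
        (hUst : ∀ b, star (U b : 𝔸) = (((U b)⁻¹ : 𝔸ˣ) : 𝔸)) (_hUb : ∀ b, U b ∈ U1 𝔸) (_hUη : ∀ b, ‖(U b : 𝔸) - 1‖ ≤ α * η)
        (_hpl : ∀ p : B9SectCLatticeCarrier.Plaq d (towerP L m (n + 1)), ‖(plaqHolU U p : 𝔸) - 1‖ ≤ α * η ^ 2)
        (_hUgrad : ∀ (x : TSite d (towerP L m (n + 1))) (μ : Fin d), ‖(U (x, μ) : 𝔸) - U (unshift μ x, μ)‖ ≤ α * η ^ 2)
        (_hRlev : ∀ (j : ℕ) (b : Bond d (towerP L m (j + 1))) (w : W), ‖adTransportW φ (UlevOf L m (n + 1) U j) b w‖ ≤ ‖w‖)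
        (_hεg : ∀ j < n + 1, εU j ≤ α * ϱ ^ j) (_hAQ : ∑ j ∈ Finset.range (n + 1), αU j ≤ AQ)
        (hpos' : ∀ x : SiteL2K ℂ d (towerP L m (n + 1)) c₀ W, x ≠ 0 → 0 < RCLike.re ⟪x, laplacePrimeAk L m n φ η U a' (c₁ := c₁) x⟫_ℂ)
        (hpos : ∀ x : BondL2K ℂ d (towerP L m (n + 1)) c₀ W, x ≠ 0 →
          0 < RCLike.re ⟪x, laplaceAk L m n φ η U hL αU hα1 hU1 hreg τ (c₀ := c₀) (c₁ := c₁) a x⟫_ℂ)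
        (v : TSite d m) (z : BondL2K ℂ d m c₁ W) (F : ℝ)
        (_hzv : ∀ b', bpos b' ≠ v → WL2.equiv ℂ (fun _ : Bond d m => c₁) W z b' = 0)
        (_hzF : ∀ b', ‖WL2.equiv ℂ (fun _ : Bond d m => c₁) W z b'‖ ≤ F) (μ : Fin d) (b : Bond d (towerP L m (n + 1))),
        ‖WL2.equiv ℂ (fun _ : Bond d (towerP L m (n + 1)) => c₀) W (covDerivL2K ℂ c₀ ((η : ℂ))⁻¹ (adTransportW φ U)
            ((WL2.equiv ℂ (fun _ : TSite d (towerP L m (n + 1)) => c₀) W).symm fun y =>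
              WL2.equiv ℂ (fun _ : Bond d (towerP L m (n + 1)) => c₀) W (H1k L m n φ η U hL αU hα1 hU1 hreg τ (c₀ := c₀) (c₁ := c₁) hαL hpos z) (y, μ))) b‖ ≤
          B * Real.exp (-(δ * tdist m (blockCoord (L ^ (n + 1)) m (siteCast (towerP_eq_fineP_pow L m (n + 1)) (bpos b))) v)) * F ∧
        ‖covGrad ((η : ℂ))⁻¹ (adTransportW φ U)
            (WL2.equiv ℂ (fun _ : Bond d (towerP L m (n + 1)) => c₀) W (H1k L m n φ η U hL αU hα1 hU1 hreg τ (c₀ := c₀) (c₁ := c₁) hαL hpos z)) (b, μ)‖ ≤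
          B * Real.exp (-(δ * tdist m (blockCoord (L ^ (n + 1)) m (siteCast (towerP_eq_fineP_pow L m (n + 1)) (bpos b))) v)) * F := by
  classical
  obtain ⟨αD, BD, δD, hαD, hBD, hδD, HD⟩ := exists_local_gradLetter_G1k hd L hL hL3 φ hMφ hMφ' hφ hφ' hstar ha ha' hϱ0 hϱ1 τ hτ hCτ hτm hMτ hρw hτ₁ hτ₂ hφτ AQ
  obtain ⟨αK, r₁, AK, hαK, hr₁, hAK, HK⟩ := exists_bondPoint_decay_Kinv_diagonal_closed hd L hL hL3 φ hMφ hMφ' hφ hφ' hstar ha ha' hϱ0 hϱ1 τ hτ hCτ hτm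
    hMτ hρw hτ₁ hτ₂ hφτ
  set κ : ℝ := min δD r₁ with hκdef
  have hκ0 : 0 < κ := lt_min hδD hr₁
  have hκD : κ ≤ δD := min_le_left _ _
  have hκK : κ ≤ r₁ := min_le_right _ _
  set MQ : ℝ := Mφ' * Real.exp (100 * d * (d + 1) * (L : ℝ) ^ d * AQ) * Mφ * ((2 * d : ℕ) : ℝ) with hMQ
  have hMQ0 : 0 ≤ MQ := by positivity
  set K : ℝ := latticeConst d (κ - κ / 2) with hKdef
  have hK0 : 0 ≤ K := latticeConst_nonneg d (by linarith)
  set Bs : ℝ := (AK * Real.sqrt d) * (MQ * Real.exp (κ * 1)) * K * (BD * Real.exp (κ * 1)) * K with hBs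
  have hBs0 : 0 ≤ Bs := by positivity
  refine ⟨min αD αK, Bs, κ / 2, lt_min hαD hαK, hBs0, by positivity, ?_⟩
  intro n η hηL c₀ c₁ _ _ hw hρ m _ hm U αU hα0 hα1 hαL hU1 hreg εU hεU hUε hLb α hα hαle hUst hUb hUη hpl hUgrad hRlev hεg hAQ hpos' hpos v z F hzv hzF
    μ b
  have hc₀ : (0 : ℝ) < c₀ := Fact.out
  have hc₁ : (0 : ℝ) < c₁ := Fact.out
  haveI : Nonempty (Bond d m) := ⟨(v, ⟨0, hd⟩)⟩
  haveI : Nonempty (Bond d (towerP L m (n + 1))) := ⟨b⟩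
  have hF0 : 0 ≤ F := (norm_nonneg _).trans (hzF (v, ⟨0, hd⟩))
  have hQ : Function.Surjective (QkW L m n φ U hL αU hα1 hU1 hreg (c₀ := c₀) (c₁ := c₁)) := QkW_surjective L m n φ U hL αU hα1 hU1 hreg hαL
  -- the coarse-bond point family
  obtain ⟨rF, hrF⟩ := exists_block_clm_family (𝕜 := ℂ) (w := fun _ : Bond d m => c₁) (V := W) (fun b' : Bond d m => bpos b')
  -- the four CLMs
  obtain ⟨Gcl, hGcl⟩ : ∃ T : BondL2K ℂ d (towerP L m (n + 1)) c₀ W →L[ℂ] BondL2K ℂ d (towerP L m (n + 1)) c₀ W,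
      T = LinearMap.toContinuousLinearMap (G1k L m n φ η U hL αU hα1 hU1 hreg τ (c₀ := c₀) (c₁ := c₁) hpos) := ⟨_, rfl⟩
  obtain ⟨Qcl, hQcl⟩ : ∃ T : BondL2K ℂ d m c₁ W →L[ℂ] BondL2K ℂ d (towerP L m (n + 1)) c₀ W,
      T = LinearMap.toContinuousLinearMap (LinearMap.adjoint (QkW L m n φ U hL αU hα1 hU1 hreg (c₀ := c₀) (c₁ := c₁))) := ⟨_, rfl⟩
  obtain ⟨Kcl, hKcl⟩ : ∃ T : BondL2K ℂ d m c₁ W →L[ℂ] BondL2K ℂ d m c₁ W, T = LinearMap.toContinuousLinearMap (KinvLatticeK hpos hQ) := ⟨_, rfl⟩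
  obtain ⟨Dcl, hDcl⟩ : ∃ T : BondL2K ℂ d (towerP L m (n + 1)) c₀ W →L[ℂ] BondL2K ℂ d (towerP L m (n + 1)) c₀ W,
      ∀ (u : BondL2K ℂ d (towerP L m (n + 1)) c₀ W) (b' : Bond d (towerP L m (n + 1))),
        WL2.equiv ℂ (fun _ : Bond d (towerP L m (n + 1)) => c₀) W (T u) b' =
          WL2.equiv ℂ (fun _ : Bond d (towerP L m (n + 1)) => c₀) W (covDerivL2K ℂ c₀ ((η : ℂ))⁻¹ (adTransportW φ U)
            ((WL2.equiv ℂ (fun _ : TSite d (towerP L m (n + 1)) => c₀) W).symm fun y =>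
              WL2.equiv ℂ (fun _ : Bond d (towerP L m (n + 1)) => c₀) W u (y, μ))) b' :=
    ⟨LinearMap.toContinuousLinearMap (covDerivL2K ℂ c₀ ((η : ℂ))⁻¹ (adTransportW φ U) ∘ₗ
        (WL2.linearEquiv ℂ ℂ (fun _ : TSite d (towerP L m (n + 1)) => c₀)).symm.toLinearMap ∘ₗ
        LinearMap.funLeft ℂ W (fun y : TSite d (towerP L m (n + 1)) => ((y, μ) : Bond d (towerP L m (n + 1)))) ∘ₗ
        (WL2.linearEquiv ℂ ℂ (fun _ : Bond d (towerP L m (n + 1)) => c₀)).toLinearMap), fun _ _ => rfl⟩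
  -- (L)(∇_μ∘G₁,k) at rate κ, re-based at `Π∘bpos`
  have hG : ∀ (v : TSite d m) (f : BondL2K ℂ d (towerP L m (n + 1)) c₀ W) (F : ℝ),
      (∀ x, blockCoord (L ^ (n + 1)) m (siteCast (towerP_eq_fineP_pow L m (n + 1)) (bpos x)) ≠ v →
        WL2.equiv ℂ (fun _ : Bond d (towerP L m (n + 1)) => c₀) W f x = 0) →
      (∀ x, ‖WL2.equiv ℂ (fun _ : Bond d (towerP L m (n + 1)) => c₀) W f x‖ ≤ F) →
      ∀ x, ‖WL2.equiv ℂ (fun _ : Bond d (towerP L m (n + 1)) => c₀) W ((Dcl ∘L Gcl) f) x‖ ≤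
        (BD * Real.exp (κ * 1)) * Real.exp (-(κ * tdist m (blockCoord (L ^ (n + 1)) m (siteCast (towerP_eq_fineP_pow L m (n + 1)) (bpos x))) v)) * F := by
    intro v f F hfv hfF x
    have hF : 0 ≤ F := (norm_nonneg _).trans (hfF x)
    have h := (HD n η hηL c₀ c₁ hw hρ m hm U αU hα0 hα1 hU1 hreg εU hεU hUε hLb α hα (hαle.trans (min_le_left _ _)) hUst hUb hUη hpl hUgrad hRlev hεg hAQ
      hpos' hpos v f F hfv hfF μ x).1
    rw [ContinuousLinearMap.comp_apply, hDcl, hGcl, LinearMap.coe_toContinuousLinearMap']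
    have hone := tdist_bigBlock_bpos_btgt_le_one (L := L) (m := m) (k := n + 1) hm x
    have htri := tdist_triangle hm (blockCoord (L ^ (n + 1)) m (siteCast (towerP_eq_fineP_pow L m (n + 1)) (bpos x)))
      (blockCoord (L ^ (n + 1)) m (siteCast (towerP_eq_fineP_pow L m (n + 1)) (btgt x))) v
    have hexp : Real.exp (-(δD * tdist m (blockCoord (L ^ (n + 1)) m (siteCast (towerP_eq_fineP_pow L m (n + 1)) (btgt x))) v)) ≤
        Real.exp (κ * 1) * Real.exp (-(κ * tdist m (blockCoord (L ^ (n + 1)) m (siteCast (towerP_eq_fineP_pow L m (n + 1)) (bpos x))) v)) := by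
      rw [← Real.exp_add]
      exact Real.exp_le_exp.2 (by nlinarith [hκ0.le, hκD, tdist_nonneg m (blockCoord (L ^ (n + 1)) m (siteCast (towerP_eq_fineP_pow L m (n + 1)) (btgt x))) v])
    calc _ ≤ BD * Real.exp (-(δD * tdist m (blockCoord (L ^ (n + 1)) m (siteCast (towerP_eq_fineP_pow L m (n + 1)) (btgt x))) v)) * F := h
      _ ≤ BD * (Real.exp (κ * 1) * Real.exp (-(κ * tdist m (blockCoord (L ^ (n + 1)) m (siteCast (towerP_eq_fineP_pow L m (n + 1)) (bpos x))) v))) * F :=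
          mul_le_mul_of_nonneg_right (mul_le_mul_of_nonneg_left hexp hBD) hF
      _ = _ := by ring
  -- `Q_k†`: size and range from the single-bond letter
  have hdiag : c₁ / c₀ * (Mφ' * ((((L : ℝ) ^ (n + 1)) ^ d)⁻¹ * Real.exp (100 * d * (d + 1) * (L : ℝ) ^ d * AQ)) * Mφ) * ((2 * d : ℕ) : ℝ) = MQ := by
    have hLp : (0 : ℝ) < ((L : ℝ) ^ (n + 1)) ^ d := by positivity
    rw [hMQ, ← hw]
    field_simp
  have hQM : ∀ (z : BondL2K ℂ d m c₁ W) (F : ℝ), (∀ x, ‖WL2.equiv ℂ (fun _ : Bond d m => c₁) W z x‖ ≤ F) →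
      ∀ x, ‖WL2.equiv ℂ (fun _ : Bond d (towerP L m (n + 1)) => c₀) W (Qcl z) x‖ ≤ MQ * F := by
    intro z F hzF x
    have hF : 0 ≤ F := (norm_nonneg _).trans (hzF (v, ⟨0, hd⟩))
    have h := norm_adjoint_QkW_apply_le_local_sharp L m n φ (c₀ := c₀) U hL αU hα0 hα1 hU1 hreg hMφ hφ hMφ' hφ' hAQ z x hF (fun c _ => hzF c)
    rw [hQcl, LinearMap.coe_toContinuousLinearMap', ← hdiag]
    exact h
  have hQρ : ∀ (v : TSite d m) (z : BondL2K ℂ d m c₁ W), (∀ x, bpos x ≠ v → WL2.equiv ℂ (fun _ : Bond d m => c₁) W z x = 0) →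
      ∀ x, (1 : ℝ) < tdist m (blockCoord (L ^ (n + 1)) m (siteCast (towerP_eq_fineP_pow L m (n + 1)) (bpos x))) v →
        WL2.equiv ℂ (fun _ : Bond d (towerP L m (n + 1)) => c₀) W (Qcl z) x = 0 := by
    intro v z hzv x hx
    have hnear : ∀ c : Bond d m, (blockCoord (L ^ (n + 1)) m (siteCast (towerP_eq_fineP_pow L m (n + 1)) x.1) = c.1 ∨
        blockCoord (L ^ (n + 1)) m (siteCast (towerP_eq_fineP_pow L m (n + 1)) x.1) = shift c.2 c.1) →
        ‖WL2.equiv ℂ (fun _ : Bond d m => c₁) W z c‖ ≤ 0 := by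
      intro c hc
      have hcv : bpos c ≠ v := by
        intro hcv
        rcases hc with h1 | h2
        · have : tdist m (blockCoord (L ^ (n + 1)) m (siteCast (towerP_eq_fineP_pow L m (n + 1)) (bpos x))) v = 0 := by
            rw [show bpos x = x.1 from rfl, h1, show c.1 = bpos c from rfl, hcv, tdist_self]
          linarith
        · have : tdist m (blockCoord (L ^ (n + 1)) m (siteCast (towerP_eq_fineP_pow L m (n + 1)) (bpos x))) v ≤ 1 := by
            rw [show bpos x = x.1 from rfl, h2, show c.1 = bpos c from rfl, hcv, tdist_symm hm]
            exact tdist_shift_le_one hm v c.2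
          linarith
      rw [hzv c hcv, norm_zero]
    have h := norm_adjoint_QkW_apply_le_local_sharp L m n φ (c₀ := c₀) U hL αU hα0 hα1 hU1 hreg hMφ hφ hMφ' hφ' hAQ z x le_rfl hnear
    rw [mul_zero] at h
    rw [hQcl, LinearMap.coe_toContinuousLinearMap']
    exact norm_le_zero_iff.1 h
  -- `K⁻¹`'s coarse point decay at rate κ
  have hKblk : ∀ y₀ y₁, ‖rF y₁ ∘L Kcl ∘L rF y₀‖ ≤ AK * Real.exp (-(κ * tdist m y₀ y₁)) := by
    intro y₀ y₁
    rw [hKcl]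
    have h := HK n η hηL c₀ c₁ hw hρ m hm U αU hα0 hα1 hαL hU1 hreg εU hεU hUε hLb α hα (hαle.trans (min_le_right _ _)) hUst hUb hUη hpl hεg hpos hQ
      rF hrF y₀ y₁
    exact h.trans (mul_le_mul_of_nonneg_left (exp_weaken' hκK (tdist_nonneg m _ _)) hAK)
  -- the coarse-bond block mass `d·c₁`
  have hμF : ∀ u : TSite d m, ∑ x : Bond d m, (if bpos x = u then c₁ else 0) ≤ (d : ℝ) * c₁ := by
    intro u
    rw [Fintype.sum_prod_type, Finset.sum_comm]
    have hin : ∀ μ : Fin d, ∑ y : TSite d m, (if bpos ((y, μ) : Bond d m) = u then c₁ else 0) = c₁ := fun μ => by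
      simp only [show ∀ y : TSite d m, bpos ((y, μ) : Bond d m) = y from fun _ => rfl, Finset.sum_ite_eq', Finset.mem_univ, if_true]
    simp only [hin, Finset.sum_const, Finset.card_univ, Fintype.card_fin, nsmul_eq_mul, le_refl]
  -- the assembly
  have hκ' : κ / 2 < κ := by linarith
  have h := local_letter_H1_torus_const (𝕜 := ℂ) (V := W)
    (fun x : Bond d (towerP L m (n + 1)) => blockCoord (L ^ (n + 1)) m (siteCast (towerP_eq_fineP_pow L m (n + 1)) (bpos x)))
    (fun b' : Bond d m => bpos b') (Dcl ∘L Gcl) Qcl Kcl hrF hm (ρ := 1) (by positivity : (0 : ℝ) ≤ BD * Real.exp (κ * 1)) hMQ0 hAK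
    (by positivity) hκ' hc₁ (fun _ => rfl) (Nat.cast_nonneg d) hμF hG hQM hQρ hKblk v z F hzv hzF b
  have e : ((Dcl ∘L Gcl) ∘L Qcl ∘L Kcl) z = Dcl (H1k L m n φ η U hL αU hα1 hU1 hreg τ (c₀ := c₀) (c₁ := c₁) hαL hpos z) := by
    have e₀ : (Gcl ∘L Qcl ∘L Kcl) z = H1k L m n φ η U hL αU hα1 hU1 hreg τ (c₀ := c₀) (c₁ := c₁) hαL hpos z := by
      rw [hGcl, hQcl, hKcl, ← toCLM_H1k_eq φ η U τ hL αU hα1 hU1 hreg hαL hpos hQ, LinearMap.coe_toContinuousLinearMap']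
    rw [← e₀]
    rfl
  rw [e, hDcl] at h
  rw [hBs, hKdef]
  exact ⟨h, norm_covGrad_apply_le_of_slice _ _ _ b μ h⟩

end Literature.MathematicalPhysics.QuantumFieldTheory.Balaban1983to89.B9Eq3126H1kSliceGradRowClosed

end
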